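import Mathlib
import Summits.ValiantsHypothesis.ValiantsHypothesis.Theorems.KPlusLogSqLawWeakLiftingTowerGraftSignedCrossingGraftSignature

/-!
# Tower graft line — SIGNED CROSSINGS XI: inertia at the ends of `(0, ∞)` and the NET co-Euler signature of a graft

Structure file for LINE (B) `Cruxes/WeakLifting/Lines/tower_graft.lean` (crux `WeakLifting` = stmt-ValiantsHypothesis-19561),
eleventh of the SIGNED-CROSSING series.  The flow laws (files III–X) are relative to a zone `[a, b]`; here the ends are computed:
for an exponent family `H u = Σ_l u^{e_l} • T_l` with a STRICTLY largest exponent `e_{l₁}` and `T_{l₁}` nonsingular, `H(u)` has the inertia of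
`T_{l₁}` (and no kernel) for all large `u`; with a strictly smallest exponent `e_{l₀}` and `T_{l₀}` nonsingular, `H(u)` has the inertia of
`T_{l₀}` for all small `u > 0`.  Hence the NET flux of a graft over the whole half-line is a number read off two letters.

§1 `negCount_congr` (bookkeeping), `negCount_smul_le` / `negCount_smul_eq'` / `negCount_smul_eq` (a positive multiple has the same inertia counts),
   `exists_inertia_eq_of_near_nonsingular` (near a NONSINGULAR symmetric `A`, every symmetric matrix has the inertia of `A` and is nonsingular).
§2 ★ `exists_inertia_eq_top` — `e_l < e_{l₁}` for `l ≠ l₁`, `T_{l₁}` nonsingular ⇒ `∃ u₁ > 0, ∀ u ≥ u₁`: `det H(u) ≠ 0`, `ν₋(H u) = ν₋(T_{l₁})`,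
   `ν₊(H u) = ν₊(T_{l₁})`.  ★ `exists_inertia_eq_bottom` — `e_{l₀} < e_l` for `l ≠ l₀`, `T_{l₀}` nonsingular ⇒ `∃ u₀ > 0, ∀ u ∈ (0, u₀]`: the same
   with `T_{l₀}`.
§3 ★★ `graft_net_signature` — NET CO-EULER SIGNATURE OF A ONE-LETTER GRAFT: `F = Σ_l u^{d_l}S_l + u^D S_far` with `d_l < D`, a strictly lowest
   letter `S_{l₀}` and `S_far` both nonsingular, `a` below / `b` above the thresholds of §2, all roots in `(a, b)` regular with co-Euler frames
   (`Qn` negative, `Qq` positive, complete): `Σ_t |κn t| + ν₋(S_far) = Σ_t |κq t| + ν₋(S_{l₀})` — over the whole positive axis the co-Euler-negative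
   root mass exceeds the co-Euler-positive one by exactly `ν₋(S_{l₀}) − ν₋(S_far)` (for the identity graft: by `ν₋(S_{l₀})`).
READING FOR THE LINE (honest): the matrix Descartes parity for grafts in exact form — the two extreme letters fix the signed count, the unsigned
count (the line's object) is twice the co-Euler-positive mass plus this constant, fold mass aside (file X).  Zero stub credit; S4/S5, TowerB,
WeakLifting, Conjecture B, 18050, VP ≠ VNP untouched.  Def-free; Mathlib + files I–X.  Seat: prover val-sym-lift-p2 g24,
`--supports stmt-ValiantsHypothesis-19561 --as helper`.  [folklore asymptotics; the packaging for the line is this work]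
-/

-- `Summit.ValiantsHypothesis.ValiantsHypothesis.…` repeats a component by the D-0017 layout
-- (single-conjunct summit), which the `dupNamespace` linter flags; the name is mandated.
set_option linter.dupNamespace false
set_option autoImplicit false

namespace Summit.ValiantsHypothesis.ValiantsHypothesis.Theorems.KPlusLogSqLaw.TowerGraft

open Matrix Finset Filter
open scoped BigOperators Topology
open Literature.Analysis.Matrix (EigenvalueCount.card_le_card_eigenvalues_lt)
open Literature.Algebra.Polynomial.MiddleMatrixSignature (card_eigenvalues_neg_add_zero_add_pos)

namespace SignedCrossing

variable {ι : Type} [Fintype ι] [DecidableEq ι]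

/-! ## §1 Positive multiples; a nonsingular matrix fixes the inertia nearby -/

/-- counting through an equality of matrices (unsorted enumeration). [folklore] -/
theorem negCount_congr {A B : Matrix ι ι ℝ} (hA : A.IsHermitian) (hB : B.IsHermitian) (hAB : A = B) (p : ℝ → Prop) [DecidablePred p] :
    (univ.filter fun i => p (hA.eigenvalues i)).card = (univ.filter fun i => p (hB.eigenvalues i)).card := by
  subst hAB
  rfl

/-- a positive multiple has at least as many negative eigenvalues (trial subspace = the negative eigen-frame of `A`). [folklore] -/
theorem negCount_smul_le {A : Matrix ι ι ℝ} (hA : A.IsHermitian) {c : ℝ} (hc : 0 < c) (hcA : (c • A).IsHermitian) :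
    (univ.filter fun i => hA.eigenvalues i < 0).card ≤ (univ.filter fun i => hcA.eigenvalues i < 0).card := by
  classical
  let p : ℝ → Prop := fun x => x < 0
  let V : Matrix ι {i // p (hA.eigenvalues i)} ℝ := Matrix.of fun x j => (hA.eigenvectorBasis j.1).ofLp x
  rw [← card_frame hA p]
  refine EigenvalueCount.card_le_card_eigenvalues_lt hcA V fun x hx => ?_
  rw [zero_mul, Matrix.smul_mulVec, dotProduct_smul, smul_eq_mul, frame_mulVec_dotProduct_mulVec hA p]
  obtain ⟨j, hj⟩ : ∃ j, x j ≠ 0 := by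
    by_contra h
    exact hx (funext fun j => by simpa using not_exists.mp h j)
  have hneg : ∑ k, hA.eigenvalues k.1 * x k ^ 2 < 0 := by
    rw [← neg_pos, ← Finset.sum_neg_distrib]
    refine lt_of_lt_of_le ?_ (Finset.single_le_sum (fun k _ => ?_) (Finset.mem_univ j))
    · have h1 : hA.eigenvalues j.1 < 0 := j.2
      have h2 : 0 < x j ^ 2 := by positivity
      nlinarith
    · have h1 : hA.eigenvalues k.1 < 0 := k.2
      nlinarith [sq_nonneg (x k)]
  exact mul_neg_of_pos_of_neg hc hneg

/-- a positive multiple has the same number of negative eigenvalues. [folklore] -/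
theorem negCount_smul_eq' {A : Matrix ι ι ℝ} (hA : A.IsHermitian) {c : ℝ} (hc : 0 < c) (hcA : (c • A).IsHermitian) :
    (univ.filter fun i => hcA.eigenvalues i < 0).card = (univ.filter fun i => hA.eigenvalues i < 0).card := by
  have hback : (c⁻¹ • (c • A)) = A := by rw [smul_smul, inv_mul_cancel₀ hc.ne', one_smul]
  have hA' : (c⁻¹ • (c • A)).IsHermitian := by rw [hback]; exact hA
  refine le_antisymm ?_ (negCount_smul_le hA hc hcA)
  have h := negCount_smul_le hcA (inv_pos.mpr hc) hA'
  rwa [negCount_congr hA' hA hback (fun x => x < 0)] at h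

/-- **a positive multiple has the same inertia counts.** [folklore] -/
theorem negCount_smul_eq {A : Matrix ι ι ℝ} (hA : A.IsHermitian) {c : ℝ} (hc : 0 < c) (hcA : (c • A).IsHermitian) :
    (univ.filter fun i => hcA.eigenvalues i < 0).card = (univ.filter fun i => hA.eigenvalues i < 0).card ∧
      (univ.filter fun i => 0 < hcA.eigenvalues i).card = (univ.filter fun i => 0 < hA.eigenvalues i).card := by
  refine ⟨negCount_smul_eq' hA hc hcA, ?_⟩
  have hnA : (c • (-A)).IsHermitian := by rw [smul_neg]; exact hcA.neg
  have h := negCount_smul_eq' hA.neg hc hnA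
  rwa [negCount_congr hnA hcA.neg (smul_neg c A) (fun x => x < 0), (negCount_neg_eq_posCount hcA hcA.neg).1,
    (negCount_neg_eq_posCount hA hA.neg).1] at h

/-- **a nonsingular symmetric matrix fixes the inertia nearby**: `∃ μ > 0`, every real symmetric `M` with `Σ|M − A| < μ` has
`ν₋(M) = ν₋(A)`, `ν₊(M) = ν₊(A)` and `det M ≠ 0`. [folklore] -/
theorem exists_inertia_eq_of_near_nonsingular {A : Matrix ι ι ℝ} (hA : A.IsHermitian) (hdet : A.det ≠ 0) :
    ∃ μ : ℝ, 0 < μ ∧ ∀ (M : Matrix ι ι ℝ) (hM : M.IsHermitian), (∑ i, ∑ j, |(M - A) i j|) < μ →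
      (univ.filter fun i => hM.eigenvalues i < 0).card = (univ.filter fun i => hA.eigenvalues i < 0).card ∧
      (univ.filter fun i => 0 < hM.eigenvalues i).card = (univ.filter fun i => 0 < hA.eigenvalues i).card ∧ M.det ≠ 0 := by
  obtain ⟨μ₁, hμ₁, h₁⟩ := exists_negCount_le_of_near hA
  obtain ⟨μ₂, hμ₂, h₂⟩ := exists_negCount_le_of_near hA.neg
  have h0 := (zeroCount_eq_zero_iff_det_ne_zero hA).mpr hdet
  have htot := card_eigenvalues_neg_add_zero_add_pos hA
  refine ⟨min μ₁ μ₂, lt_min hμ₁ hμ₂, fun M hM hnear => ?_⟩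
  have hn := h₁ M hM (hnear.trans_le (min_le_left _ _))
  have hp : (univ.filter fun i => 0 < hA.eigenvalues i).card ≤ (univ.filter fun i => 0 < hM.eigenvalues i).card := by
    have h := h₂ (-M) hM.neg (by
      have : (∑ i, ∑ j, |(-M - -A) i j|) = ∑ i, ∑ j, |(M - A) i j| :=
        Finset.sum_congr rfl fun i _ => Finset.sum_congr rfl fun j _ => by
          rw [show (-M - -A) = -(M - A) by abel, Matrix.neg_apply, abs_neg]
      rw [this]; exact hnear.trans_le (min_le_right _ _))
    rwa [(negCount_neg_eq_posCount hA hA.neg).1, (negCount_neg_eq_posCount hM hM.neg).1] at h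
  have htot' := card_eigenvalues_neg_add_zero_add_pos hM
  rw [← zeroCount_eq_zero_iff_det_ne_zero hM]
  omega

/-! ## §2 Inertia of an exponent family at the two ends of `(0, ∞)` -/

section Ends

variable {κ : Type} [Fintype κ] [DecidableEq κ]

omit [DecidableEq ι] in
/-- size of the tail of the rescaled family: for `u ≥ 1` and exponents `e_l < e₁` (`l ≠ l₁`),
`Σ_{i,j} |Σ_{l ≠ l₁} u^{e_l}/u^{e₁} · T_l i j| ≤ u⁻¹ · Σ_{l ≠ l₁} Σ_{i,j} |T_l i j|`. [folklore] -/
theorem tail_size_le_top (e : κ → ℕ) (Tm : κ → Matrix ι ι ℝ) (l₁ : κ) (htop : ∀ l, l ≠ l₁ → e l < e l₁) {u : ℝ} (hu : 1 ≤ u) :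
    (∑ i, ∑ j, |(∑ l ∈ univ.erase l₁, ((u ^ e l₁)⁻¹ * u ^ e l) • Tm l) i j|) ≤ u⁻¹ * ∑ l ∈ univ.erase l₁, ∑ i, ∑ j, |Tm l i j| := by
  have hu0 : 0 < u := one_pos.trans_le hu
  have hcoef : ∀ l ∈ univ.erase l₁, |(u ^ e l₁)⁻¹ * u ^ e l| ≤ u⁻¹ := by
    intro l hl
    have hne : l ≠ l₁ := Finset.ne_of_mem_erase hl
    have hlt := htop l hne
    rw [abs_of_nonneg (by positivity), inv_mul_le_iff₀ (by positivity), ← div_eq_mul_inv, le_div_iff₀ hu0, ← pow_succ]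
    exact pow_le_pow_right₀ hu (by omega)
  calc (∑ i, ∑ j, |(∑ l ∈ univ.erase l₁, ((u ^ e l₁)⁻¹ * u ^ e l) • Tm l) i j|)
      ≤ ∑ i, ∑ j, ∑ l ∈ univ.erase l₁, u⁻¹ * |Tm l i j| := by
        refine Finset.sum_le_sum fun i _ => Finset.sum_le_sum fun j _ => ?_
        rw [Matrix.sum_apply]
        refine (Finset.abs_sum_le_sum_abs _ _).trans (Finset.sum_le_sum fun l hl => ?_)
        rw [Matrix.smul_apply, smul_eq_mul, abs_mul]
        exact mul_le_mul_of_nonneg_right (hcoef l hl) (abs_nonneg _)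
    _ = ∑ i, ∑ l ∈ univ.erase l₁, ∑ j, u⁻¹ * |Tm l i j| := Finset.sum_congr rfl fun i _ => Finset.sum_comm
    _ = ∑ l ∈ univ.erase l₁, ∑ i, ∑ j, u⁻¹ * |Tm l i j| := Finset.sum_comm
    _ = u⁻¹ * ∑ l ∈ univ.erase l₁, ∑ i, ∑ j, |Tm l i j| := by simp only [Finset.mul_sum]

/-- **inertia at the top end.**  `H u = Σ_l u^{e_l}•T_l`, symmetric letters, `e_l < e_{l₁}` for `l ≠ l₁`, `T_{l₁}` nonsingular ⇒ `∃ u₁ > 0` such that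
for all `u ≥ u₁`: `det H(u) ≠ 0`, `ν₋(H u) = ν₋(T_{l₁})`, `ν₊(H u) = ν₊(T_{l₁})`. [folklore; packaging this work] -/
theorem exists_inertia_eq_top (e : κ → ℕ) (Tm : κ → Matrix ι ι ℝ) (hTm : ∀ l, (Tm l).IsSymm) (l₁ : κ) (htop : ∀ l, l ≠ l₁ → e l < e l₁)
    (hdet : (Tm l₁).det ≠ 0) :
    ∃ u₁ : ℝ, 0 < u₁ ∧ ∀ u, u₁ ≤ u → (∑ l, (u ^ e l) • Tm l).det ≠ 0 ∧
      (univ.filter fun i => (SteepZone.isHermitian_family (fun l => u ^ e l) Tm hTm).eigenvalues i < 0).card =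
        (univ.filter fun i => (SteepZone.isHermitian_family (fun _ => (1 : ℝ)) (fun _ : Unit => Tm l₁) (fun _ => hTm l₁)).eigenvalues i < 0).card ∧
      (univ.filter fun i => 0 < (SteepZone.isHermitian_family (fun l => u ^ e l) Tm hTm).eigenvalues i).card =
        (univ.filter fun i => 0 < (SteepZone.isHermitian_family (fun _ => (1 : ℝ)) (fun _ : Unit => Tm l₁) (fun _ => hTm l₁)).eigenvalues i).card := by
  classical
  have hT1 : (Tm l₁).IsHermitian := by
    simpa using SteepZone.isHermitian_family (fun _ => (1 : ℝ)) (fun _ : Unit => Tm l₁) (fun _ => hTm l₁)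
  have hone : (∑ _l : Unit, (1 : ℝ) • Tm l₁) = Tm l₁ := by simp
  obtain ⟨μ, hμ, hnear⟩ := exists_inertia_eq_of_near_nonsingular hT1 hdet
  set C : ℝ := ∑ l ∈ univ.erase l₁, ∑ i, ∑ j, |Tm l i j| with hC
  have hC0 : 0 ≤ C := Finset.sum_nonneg fun l _ => Finset.sum_nonneg fun i _ => Finset.sum_nonneg fun j _ => abs_nonneg _
  refine ⟨max 1 (C / μ + 1), lt_max_of_lt_left one_pos, fun u hu => ?_⟩
  have hu1 : 1 ≤ u := (le_max_left _ _).trans hu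
  have hu0 : 0 < u := one_pos.trans_le hu1
  have huC : C / μ + 1 ≤ u := (le_max_right _ _).trans hu
  -- the rescaled family is near `T l₁`
  set c : ℝ := (u ^ e l₁)⁻¹ with hc
  have hcpos : 0 < c := by rw [hc]; positivity
  have hresc : c • (∑ l, (u ^ e l) • Tm l) = Tm l₁ + ∑ l ∈ univ.erase l₁, (c * u ^ e l) • Tm l := by
    rw [Finset.smul_sum, ← Finset.add_sum_erase _ _ (Finset.mem_univ l₁)]
    congr 1
    · rw [smul_smul, hc, inv_mul_cancel₀ (by positivity), one_smul]
    · exact Finset.sum_congr rfl fun l _ => by rw [smul_smul]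
  have hcH : (c • ∑ l, (u ^ e l) • Tm l).IsHermitian := by
    unfold Matrix.IsHermitian
    rw [Matrix.conjTranspose_smul, star_trivial, (SteepZone.isHermitian_family (fun l => u ^ e l) Tm hTm).eq]
  have hsize : (∑ i, ∑ j, |(c • (∑ l, (u ^ e l) • Tm l) - Tm l₁) i j|) < μ := by
    rw [hresc, add_sub_cancel_left]
    refine (tail_size_le_top e Tm l₁ htop hu1).trans_lt ?_
    rw [← hC]
    have h1 : u⁻¹ * C ≤ C / u := by rw [div_eq_mul_inv, mul_comm]
    have h2 : C / u < μ := by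
      rw [div_lt_iff₀ hu0]
      have : C < μ * (C / μ + 1) := by rw [mul_add, mul_div_cancel₀ _ hμ.ne']; linarith
      nlinarith
    linarith
  obtain ⟨hn, hp, hd⟩ := hnear _ hcH hsize
  obtain ⟨hsn, hsp⟩ := negCount_smul_eq (SteepZone.isHermitian_family (fun l => u ^ e l) Tm hTm) hcpos hcH
  refine ⟨fun h0 => hd (by rw [Matrix.det_smul, h0, mul_zero]), ?_, ?_⟩
  · rw [← hsn, hn]
    exact negCount_congr hT1 _ hone.symm (fun x => x < 0)
  · rw [← hsp, hp]
    exact negCount_congr hT1 _ hone.symm (fun x => 0 < x)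

omit [DecidableEq ι] in
/-- size of the tail at the bottom end: for `0 < u ≤ 1` and exponents `e₀ < e_l` (`l ≠ l₀`),
`Σ_{i,j} |Σ_{l ≠ l₀} u^{e_l}/u^{e₀} · T_l i j| ≤ u · Σ_{l ≠ l₀} Σ_{i,j} |T_l i j|`. [folklore] -/
theorem tail_size_le_bottom (e : κ → ℕ) (Tm : κ → Matrix ι ι ℝ) (l₀ : κ) (hbot : ∀ l, l ≠ l₀ → e l₀ < e l) {u : ℝ} (hu0 : 0 < u)
    (hu1 : u ≤ 1) :
    (∑ i, ∑ j, |(∑ l ∈ univ.erase l₀, ((u ^ e l₀)⁻¹ * u ^ e l) • Tm l) i j|) ≤ u * ∑ l ∈ univ.erase l₀, ∑ i, ∑ j, |Tm l i j| := by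
  have hcoef : ∀ l ∈ univ.erase l₀, |(u ^ e l₀)⁻¹ * u ^ e l| ≤ u := by
    intro l hl
    have hne : l ≠ l₀ := Finset.ne_of_mem_erase hl
    have hlt := hbot l hne
    rw [abs_of_nonneg (by positivity), inv_mul_le_iff₀ (by positivity), ← pow_succ]
    exact pow_le_pow_of_le_one hu0.le hu1 (by omega)
  calc (∑ i, ∑ j, |(∑ l ∈ univ.erase l₀, ((u ^ e l₀)⁻¹ * u ^ e l) • Tm l) i j|)
      ≤ ∑ i, ∑ j, ∑ l ∈ univ.erase l₀, u * |Tm l i j| := by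
        refine Finset.sum_le_sum fun i _ => Finset.sum_le_sum fun j _ => ?_
        rw [Matrix.sum_apply]
        refine (Finset.abs_sum_le_sum_abs _ _).trans (Finset.sum_le_sum fun l hl => ?_)
        rw [Matrix.smul_apply, smul_eq_mul, abs_mul]
        exact mul_le_mul_of_nonneg_right (hcoef l hl) (abs_nonneg _)
    _ = ∑ i, ∑ l ∈ univ.erase l₀, ∑ j, u * |Tm l i j| := Finset.sum_congr rfl fun i _ => Finset.sum_comm
    _ = ∑ l ∈ univ.erase l₀, ∑ i, ∑ j, u * |Tm l i j| := Finset.sum_comm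
    _ = u * ∑ l ∈ univ.erase l₀, ∑ i, ∑ j, |Tm l i j| := by simp only [Finset.mul_sum]

/-- **inertia at the bottom end.**  `e_{l₀} < e_l` for `l ≠ l₀`, `T_{l₀}` nonsingular ⇒ `∃ u₀ > 0` such that for all `0 < u ≤ u₀`: `det H(u) ≠ 0`,
`ν₋(H u) = ν₋(T_{l₀})`, `ν₊(H u) = ν₊(T_{l₀})`. [folklore; packaging this work] -/
theorem exists_inertia_eq_bottom (e : κ → ℕ) (Tm : κ → Matrix ι ι ℝ) (hTm : ∀ l, (Tm l).IsSymm) (l₀ : κ)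
    (hbot : ∀ l, l ≠ l₀ → e l₀ < e l) (hdet : (Tm l₀).det ≠ 0) :
    ∃ u₀ : ℝ, 0 < u₀ ∧ ∀ u, 0 < u → u ≤ u₀ → (∑ l, (u ^ e l) • Tm l).det ≠ 0 ∧
      (univ.filter fun i => (SteepZone.isHermitian_family (fun l => u ^ e l) Tm hTm).eigenvalues i < 0).card =
        (univ.filter fun i => (SteepZone.isHermitian_family (fun _ => (1 : ℝ)) (fun _ : Unit => Tm l₀) (fun _ => hTm l₀)).eigenvalues i < 0).card ∧
      (univ.filter fun i => 0 < (SteepZone.isHermitian_family (fun l => u ^ e l) Tm hTm).eigenvalues i).card =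
        (univ.filter fun i => 0 < (SteepZone.isHermitian_family (fun _ => (1 : ℝ)) (fun _ : Unit => Tm l₀) (fun _ => hTm l₀)).eigenvalues i).card := by
  classical
  have hT0 : (Tm l₀).IsHermitian := by
    simpa using SteepZone.isHermitian_family (fun _ => (1 : ℝ)) (fun _ : Unit => Tm l₀) (fun _ => hTm l₀)
  have hone : (∑ _l : Unit, (1 : ℝ) • Tm l₀) = Tm l₀ := by simp
  obtain ⟨μ, hμ, hnear⟩ := exists_inertia_eq_of_near_nonsingular hT0 hdet
  set C : ℝ := ∑ l ∈ univ.erase l₀, ∑ i, ∑ j, |Tm l i j| with hC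
  have hC0 : 0 ≤ C := Finset.sum_nonneg fun l _ => Finset.sum_nonneg fun i _ => Finset.sum_nonneg fun j _ => abs_nonneg _
  refine ⟨min 1 (μ / (C + 1)), lt_min one_pos (by positivity), fun u hu0 hu => ?_⟩
  have hu1 : u ≤ 1 := hu.trans (min_le_left _ _)
  have huC : u ≤ μ / (C + 1) := hu.trans (min_le_right _ _)
  set c : ℝ := (u ^ e l₀)⁻¹ with hc
  have hcpos : 0 < c := by rw [hc]; positivity
  have hresc : c • (∑ l, (u ^ e l) • Tm l) = Tm l₀ + ∑ l ∈ univ.erase l₀, (c * u ^ e l) • Tm l := by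
    rw [Finset.smul_sum, ← Finset.add_sum_erase _ _ (Finset.mem_univ l₀)]
    congr 1
    · rw [smul_smul, hc, inv_mul_cancel₀ (by positivity), one_smul]
    · exact Finset.sum_congr rfl fun l _ => by rw [smul_smul]
  have hcH : (c • ∑ l, (u ^ e l) • Tm l).IsHermitian := by
    unfold Matrix.IsHermitian
    rw [Matrix.conjTranspose_smul, star_trivial, (SteepZone.isHermitian_family (fun l => u ^ e l) Tm hTm).eq]
  have hsize : (∑ i, ∑ j, |(c • (∑ l, (u ^ e l) • Tm l) - Tm l₀) i j|) < μ := by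
    rw [hresc, add_sub_cancel_left]
    refine (tail_size_le_bottom e Tm l₀ hbot hu0 hu1).trans_lt ?_
    rw [← hC]
    have h2 : u * C < μ := by
      have h3 : u * (C + 1) ≤ μ := by rwa [le_div_iff₀ (by positivity)] at huC
      nlinarith
    exact h2
  obtain ⟨hn, hp, hd⟩ := hnear _ hcH hsize
  obtain ⟨hsn, hsp⟩ := negCount_smul_eq (SteepZone.isHermitian_family (fun l => u ^ e l) Tm hTm) hcpos hcH
  refine ⟨fun h0 => hd (by rw [Matrix.det_smul, h0, mul_zero]), ?_, ?_⟩
  · rw [← hsn, hn]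
    exact negCount_congr hT0 _ hone.symm (fun x => x < 0)
  · rw [← hsp, hp]
    exact negCount_congr hT0 _ hone.symm (fun x => 0 < x)

end Ends

/-! ## §3 The ends of a one-letter graft and its net co-Euler signature -/

section Graft

variable {m K : ℕ}

/-- **the ends of a one-letter graft.**  `F = Σ_l u^{d_l}S_l + u^D S_far` with `d_l < D` for all `l`, a strictly lowest exponent `d_{l₀}`, and
`S_{l₀}`, `S_far` nonsingular: for all small `a > 0`, `det F(a) ≠ 0` and `ν₋(F a) = ν₋(S_{l₀})`; for all large `b`, `det F(b) ≠ 0` and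
`ν₋(F b) = ν₋(S_far)`. [folklore; packaging this work] -/
theorem graft_ends (D : ℕ) (d : Fin K → ℕ) (hdD : ∀ l, d l < D) (S : Fin K → Matrix (Fin m) (Fin m) ℝ) (hS : ∀ l, (S l).IsSymm)
    (Sfar : Matrix (Fin m) (Fin m) ℝ) (hSfar : Sfar.IsSymm) (l₀ : Fin K) (hbot : ∀ l, l ≠ l₀ → d l₀ < d l)
    (hS0h : (S l₀).IsHermitian) (hS0 : (S l₀).det ≠ 0) (hSfh : Sfar.IsHermitian) (hSf : Sfar.det ≠ 0) :
    ∃ u₀ u₁ : ℝ, 0 < u₀ ∧ 0 < u₁ ∧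
      (∀ a, 0 < a → a ≤ u₀ → ((∑ l, (a ^ d l) • S l) + (a ^ D) • Sfar).det ≠ 0 ∧
        (univ.filter fun i => (ZoneFlux.isHermitian_graft D d S hS Sfar hSfar a).eigenvalues i < 0).card =
          (univ.filter fun i => hS0h.eigenvalues i < 0).card) ∧
      (∀ b, u₁ ≤ b → ((∑ l, (b ^ d l) • S l) + (b ^ D) • Sfar).det ≠ 0 ∧
        (univ.filter fun i => (ZoneFlux.isHermitian_graft D d S hS Sfar hSfar b).eigenvalues i < 0).card =
          (univ.filter fun i => hSfh.eigenvalues i < 0).card) := by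
  classical
  let e : Fin (K + 1) → ℕ := Fin.snoc d D
  let Tm : Fin (K + 1) → Matrix (Fin m) (Fin m) ℝ := Fin.snoc S Sfar
  have hTm : ∀ l, (Tm l).IsSymm := by
    intro l
    induction l using Fin.lastCases with
    | last => simpa [Tm] using hSfar
    | cast l => simpa [Tm] using hS l
  have hfam : ∀ u : ℝ, (∑ l, (u ^ e l) • Tm l) = (∑ l, (u ^ d l) • S l) + (u ^ D) • Sfar := fun u =>
    (graft_eq_family D d S Sfar u).symm
  have htop : ∀ l, l ≠ Fin.last K → e l < e (Fin.last K) := by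
    intro l hl
    rcases Fin.eq_castSucc_or_eq_last l with ⟨j, rfl⟩ | h
    · simp only [e, Fin.snoc_castSucc, Fin.snoc_last]
      exact hdD j
    · exact absurd h hl
  have hbot' : ∀ l, l ≠ Fin.castSucc l₀ → e (Fin.castSucc l₀) < e l := by
    intro l hl
    rcases Fin.eq_castSucc_or_eq_last l with ⟨j, rfl⟩ | rfl
    · have hj : j ≠ l₀ := fun h => hl (by rw [h])
      simp only [e, Fin.snoc_castSucc]
      exact hbot j hj
    · simp only [e, Fin.snoc_castSucc, Fin.snoc_last]
      exact hdD l₀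
  have hdet1 : (Tm (Fin.last K)).det ≠ 0 := by simpa [Tm] using hSf
  have hdet0 : (Tm (Fin.castSucc l₀)).det ≠ 0 := by simpa [Tm] using hS0
  obtain ⟨u₁, hu₁, htopu⟩ := exists_inertia_eq_top e Tm hTm (Fin.last K) htop hdet1
  obtain ⟨u₀, hu₀, hbotu⟩ := exists_inertia_eq_bottom e Tm hTm (Fin.castSucc l₀) hbot' hdet0
  have hlast : (∑ _l : Unit, (1 : ℝ) • Tm (Fin.last K)) = Sfar := by simp [Tm]
  have hcast : (∑ _l : Unit, (1 : ℝ) • Tm (Fin.castSucc l₀)) = S l₀ := by simp [Tm]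
  refine ⟨u₀, u₁, hu₀, hu₁, fun a ha hau => ?_, fun b hb => ?_⟩
  · obtain ⟨hd, hn, -⟩ := hbotu a ha hau
    refine ⟨by rw [← hfam a]; exact hd, ?_⟩
    rw [negCount_congr (ZoneFlux.isHermitian_graft D d S hS Sfar hSfar a) (SteepZone.isHermitian_family (fun l => a ^ e l) Tm hTm)
      (hfam a).symm (fun x => x < 0), hn]
    exact negCount_congr _ hS0h hcast (fun x => x < 0)
  · obtain ⟨hd, hn, -⟩ := htopu b hb
    refine ⟨by rw [← hfam b]; exact hd, ?_⟩
    rw [negCount_congr (ZoneFlux.isHermitian_graft D d S hS Sfar hSfar b) (SteepZone.isHermitian_family (fun l => b ^ e l) Tm hTm)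
      (hfam b).symm (fun x => x < 0), hn]
    exact negCount_congr _ hSfh hlast (fun x => x < 0)

/-- **NET CO-EULER SIGNATURE OF A ONE-LETTER GRAFT.**  In the setting of `graft_ends`, there are thresholds `0 < u₀`, `0 < u₁` such that for every
zone `[a, b]` with `0 < a ≤ u₀`, `u₁ ≤ b`, `a ≤ b`, every finite `T ⊆ (a, b)` containing the roots of `det F`, and complete co-Euler frames at the
roots (`Qn` negative, `Qq` positive, `|κn| + |κq| = ν₀`):  `Σ_t |κn t| + ν₋(S_far) = Σ_t |κq t| + ν₋(S_{l₀})`. [this work] -/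
theorem graft_net_signature (D : ℕ) (d : Fin K → ℕ) (hdD : ∀ l, d l < D) (S : Fin K → Matrix (Fin m) (Fin m) ℝ) (hS : ∀ l, (S l).IsSymm)
    (Sfar : Matrix (Fin m) (Fin m) ℝ) (hSfar : Sfar.IsSymm) (l₀ : Fin K) (hbot : ∀ l, l ≠ l₀ → d l₀ < d l)
    (hS0h : (S l₀).IsHermitian) (hS0 : (S l₀).det ≠ 0) (hSfh : Sfar.IsHermitian) (hSf : Sfar.det ≠ 0) :
    ∃ u₀ u₁ : ℝ, 0 < u₀ ∧ 0 < u₁ ∧ ∀ (a b : ℝ), 0 < a → a ≤ u₀ → u₁ ≤ b → a ≤ b →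
      ∀ (T : Finset ℝ), (∀ t ∈ T, a < t ∧ t < b) →
      (∀ u, a < u → u < b → ((∑ l, (u ^ d l) • S l) + (u ^ D) • Sfar).det = 0 → u ∈ T) →
      ∀ (κn κq : ℝ → Type) [∀ t, Fintype (κn t)] [∀ t, Fintype (κq t)]
        (Qn : ∀ t, Matrix (Fin m) (κn t) ℝ) (Qq : ∀ t, Matrix (Fin m) (κq t) ℝ),
      (∀ t ∈ T, ∀ c : κn t → ℝ, ((∑ l, (t ^ d l) • S l) + (t ^ D) • Sfar) *ᵥ (Qn t *ᵥ c) = 0) →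
      (∀ t ∈ T, ∀ c : κn t → ℝ, c ≠ 0 → (Qn t *ᵥ c) ⬝ᵥ (∑ l, (((D - d l : ℕ) : ℝ) * t ^ d l) • S l) *ᵥ (Qn t *ᵥ c) < 0) →
      (∀ t ∈ T, ∀ c : κq t → ℝ, ((∑ l, (t ^ d l) • S l) + (t ^ D) • Sfar) *ᵥ (Qq t *ᵥ c) = 0) →
      (∀ t ∈ T, ∀ c : κq t → ℝ, c ≠ 0 → 0 < (Qq t *ᵥ c) ⬝ᵥ (∑ l, (((D - d l : ℕ) : ℝ) * t ^ d l) • S l) *ᵥ (Qq t *ᵥ c)) →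
      (∀ t ∈ T, Fintype.card (κn t) + Fintype.card (κq t) =
        (univ.filter fun i => (ZoneFlux.isHermitian_graft D d S hS Sfar hSfar t).eigenvalues i = 0).card) →
      (∑ t ∈ T, Fintype.card (κn t)) + (univ.filter fun i => hSfh.eigenvalues i < 0).card =
        (∑ t ∈ T, Fintype.card (κq t)) + (univ.filter fun i => hS0h.eigenvalues i < 0).card := by
  obtain ⟨u₀, u₁, hu₀, hu₁, hlow, hhigh⟩ := graft_ends D d hdD S hS Sfar hSfar l₀ hbot hS0h hS0 hSfh hSf
  refine ⟨u₀, u₁, hu₀, hu₁, fun a b ha hau hbu hab T hT hcov κn κq _ _ Qn Qq hQnker hQn hQqker hQq hreg => ?_⟩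
  obtain ⟨ha0, hνa⟩ := hlow a ha hau
  obtain ⟨hb0, hνb⟩ := hhigh b hbu
  have h := graft_signature D d (fun l => (hdD l).le) S hS Sfar hSfar ha hab ha0 hb0 T hT hcov κn κq Qn Qq hQnker hQn hQqker hQq hreg
  rw [hνa, hνb] at h
  exact h

end Graft

end SignedCrossing

end Summit.ValiantsHypothesis.ValiantsHypothesis.Theorems.KPlusLogSqLaw.TowerGraft
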